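import Summits.NavierStokesRegularity.NavierStokesRegularity.Theorems.TypeICertificateLadderTargetStretchingDepletionOne
import Literature.Analysis.FluidPDE.LambFormCurlKernel
import Literature.Analysis.FluidPDE.VorticityCalculus
import HarnessLib

/-!
# Crux `Target` = `TypeICertificateLadder.NoTypeIBlowup` (stmt-NavierStokesRegularity-1217), line
# `depletion-ladder`, stub S1 `stub_depletionBelowHalf`: the stretching integral IS the vorticity–Lamb pairing

`--supports stmt-NavierStokesRegularity-1217` (line `depletion-ladder`, skeleton
`Cruxes/Target/Lines/depletion_ladder.lean`; route (ii) of the line's S1 census — structure of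
near-extremisers — first file: the exact Lamb-pairing form of S1's functional on the EXACT class of
the line's definition `DepletionLadder.StretchingDepletion`: `u ∈ C²` divergence-free, `|u| ≤ M`,
`ω = curl u ∈ L²`, `|∇ω|_F ∈ L²`, integrable stretching density; NO decay of `u`, NO energy).

* `integral_cutoff_mul_stretching_eq` — with the tree's smooth cut-off `χ = cutoff R`:
  `∫ χ⟪ω, Du ω⟫ = −∫ (Dχ ω)⟪u, ω⟫ + ∫ χ⟪u, ω × curl ω⟫ + ∫ ½‖ω‖²⟪u, ∇χ⟫`
  (trilinear integration by parts `integral_inner_convect_add_eq_zero` with `div ω = 0`, the Lamb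
  form `Dω ω = curl ω × ω + ∇(½‖ω‖²)` (`convect_self_eq_cross_curl_add_gradient`), and
  `∫χ⟪u, ∇(½‖ω‖²)⟫ = −∫ ½‖ω‖²⟪u, ∇χ⟫` by `div u = 0`).
* `integral_stretching_eq_integral_inner_cross` — letting `R → ∞` (the two cut-off errors are
  `≤ C·M·‖ω‖₂²/R`; dominated convergence for the main terms):
  `∫ ⟪ω, Du ω⟫ = ∫ ⟪u, ω × curl ω⟫`, the right integrand being integrable on the class
  (`integrable_inner_cross_curl`: `|⟪u, ω × curl ω⟫| ≤ M‖ω‖‖curl ω‖`).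

So on the definition's class S1 reads `|∫⟪u, ω × curl ω⟫| ≤ κ M ‖ω‖₂ ‖∇ω‖₂`: Cauchy–Schwarz
saturation needs `u ∥ ω × curl ω`, `ω ⊥ curl ω`, `|curl ω| ∝ |ω|` — the companion file
`…TargetDepletionAlignmentDefect.lean` turns this into the defect laws `R² + D ≤ 1`, `R² + A ≤ 1`.
WHAT THIS IS NOT: no depletion constant; an exact identity (and the two coordinate identities for the triple product it needs).
Elementary. [folklore]

References: Constantin, Comm. Math. Phys. 129 (1990) 241–266, (2.9)–(2.11) (stretching in Lamb
variables); Majda–Bertozzi 2002, §2.1 (Lamb form); Leray 1934 §6 (1.11) (integration by parts).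
-/

noncomputable section

open Set Function Filter Topology MeasureTheory
open scoped RealInnerProductSpace ENNReal NNReal ContDiff
open Literature.Analysis.FluidPDE

namespace Summit.NavierStokesRegularity.NavierStokesRegularity.Theorems.DepletionLadder

-- the problem directory repeats the summit name (`NavierStokesRegularity/NavierStokesRegularity`)
set_option linter.dupNamespace false

/-! ## Pointwise algebra in `ℝ³` -/

/-- Coordinates of `⟪u, a × c⟫` (the triple product). [folklore] -/
theorem inner_cross_eq (u a c : EuclideanSpace ℝ (Fin 3)) :
    ⟪u, cross a c⟫ = u 0 * (a 1 * c 2 - a 2 * c 1) + u 1 * (a 2 * c 0 - a 0 * c 2) +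
      u 2 * (a 0 * c 1 - a 1 * c 0) := by
  simp [cross, cross_apply, PiLp.inner_apply, Fin.sum_univ_three]
  ring

/-- `⟪u, a × c⟫ = −⟪u, c × a⟫`. [folklore] -/
theorem inner_cross_swap (u a c : EuclideanSpace ℝ (Fin 3)) : ⟪u, cross a c⟫ = -⟪u, cross c a⟫ := by
  rw [inner_cross_eq, inner_cross_eq]; ring

/-! ## Regularity and integrability on the definition's class -/

section Class

variable {u : EuclideanSpace ℝ (Fin 3) → EuclideanSpace ℝ (Fin 3)} {M : ℝ}

/-- `curl u ∈ C¹` for `u ∈ C²`. [folklore] -/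
theorem contDiff_one_curl_of_contDiff_two (hu : ContDiff ℝ 2 u) : ContDiff ℝ 1 (curl u) := by
  rw [curl_eq_curlCLM_comp]
  exact curlCLM.contDiff.comp (hu.fderiv_right (m := 1) (by norm_num))

/-- `‖curl u‖ ∈ L²` as a `MemLp` statement. [folklore] -/
theorem memLp_two_norm_curl (hu : ContDiff ℝ 2 u) (iZ : Integrable (fun x => ‖curl u x‖ ^ 2)) :
    MemLp (fun x => ‖curl u x‖) 2 volume :=
  (memLp_two_iff_integrable_sq
    (continuous_curl (hu.of_le (by norm_num))).norm.aestronglyMeasurable).2 iZ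

/-- `‖curl curl u‖² ≤ ‖curlCLM‖² |∇ curl u|²_F` is integrable when `|∇ curl u|_F ∈ L²`. [folklore] -/
theorem integrable_norm_curl_curl_sq (hu : ContDiff ℝ 2 u)
    (iA : Integrable (fun x => frobeniusNormSq (fderiv ℝ (curl u) x))) :
    Integrable (fun x => ‖curl (curl u) x‖ ^ 2) := by
  refine (iA.const_mul (‖curlCLM‖ ^ 2)).mono'
    ((continuous_curl (contDiff_one_curl_of_contDiff_two hu)).norm.pow 2).aestronglyMeasurable
    (Eventually.of_forall fun x => ?_)
  rw [Real.norm_of_nonneg (sq_nonneg _)]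
  exact norm_curl_sq_le_frobeniusNormSq _ _

/-- `‖curl curl u‖ ∈ L²` as a `MemLp` statement. [folklore] -/
theorem memLp_two_norm_curl_curl (hu : ContDiff ℝ 2 u)
    (iA : Integrable (fun x => frobeniusNormSq (fderiv ℝ (curl u) x))) :
    MemLp (fun x => ‖curl (curl u) x‖) 2 volume :=
  (memLp_two_iff_integrable_sq
    (continuous_curl (contDiff_one_curl_of_contDiff_two hu)).norm.aestronglyMeasurable).2
    (integrable_norm_curl_curl_sq hu iA)

/-- The vorticity–Lamb pairing density `⟪u, ω × curl ω⟫` is continuous. [folklore] -/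
theorem continuous_inner_cross_curl (hu : ContDiff ℝ 2 u) :
    Continuous fun x => ⟪u x, cross (curl u x) (curl (curl u) x)⟫ := by
  have cω : Continuous (curl u) := continuous_curl (hu.of_le (by norm_num))
  have cc : Continuous (curl (curl u)) := continuous_curl (contDiff_one_curl_of_contDiff_two hu)
  exact hu.continuous.inner ((crossCLM.continuous.comp cω).clm_apply cc)

/-- On the class of `StretchingDepletion` the vorticity–Lamb pairing density is integrable:
`|⟪u, ω × curl ω⟫| ≤ M‖ω‖‖curl ω‖ ∈ L¹`. [folklore] -/
theorem integrable_inner_cross_curl (hu : ContDiff ℝ 2 u) (hM : ∀ x, ‖u x‖ ≤ M)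
    (iZ : Integrable (fun x => ‖curl u x‖ ^ 2))
    (iA : Integrable (fun x => frobeniusNormSq (fderiv ℝ (curl u) x))) :
    Integrable (fun x => ⟪u x, cross (curl u x) (curl (curl u) x)⟫) := by
  have hprod : Integrable (fun x => ‖curl u x‖ * ‖curl (curl u) x‖) :=
    (memLp_two_norm_curl hu iZ).integrable_mul (memLp_two_norm_curl_curl hu iA)
  refine (hprod.const_mul M).mono' (continuous_inner_cross_curl hu).aestronglyMeasurable
    (Eventually.of_forall fun x => ?_)
  rw [Real.norm_eq_abs]
  calc |⟪u x, cross (curl u x) (curl (curl u) x)⟫|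
      ≤ ‖u x‖ * ‖cross (curl u x) (curl (curl u) x)‖ := abs_real_inner_le_norm _ _
    _ ≤ M * (‖curl u x‖ * ‖curl (curl u) x‖) := by
        -- `‖a × c‖ ≤ ‖a‖‖c‖` (tree `norm_cross`: `‖a × c‖ = ‖a‖‖c‖ sin ∠(a, c)`)
        have hx : ‖cross (curl u x) (curl (curl u) x)‖ ≤ ‖curl u x‖ * ‖curl (curl u) x‖ := by
          rw [norm_cross]
          exact mul_le_of_le_one_right (by positivity) (Real.sin_le_one _)
        exact mul_le_mul (hM x) hx (norm_nonneg _) ((norm_nonneg _).trans (hM x))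

/-- Product rule for the gradient of a product of two real `C¹` functions. [folklore] -/
theorem gradient_mul_apply {E' : Type*} [NormedAddCommGroup E'] [InnerProductSpace ℝ E'] [CompleteSpace E']
    {f g : E' → ℝ} {x : E'} (hf : DifferentiableAt ℝ f x) (hg : DifferentiableAt ℝ g x) :
    gradient (fun y => f y * g y) x = f x • gradient g x + g x • gradient f x := by
  simp [gradient, fderiv_fun_mul hf hg, map_add]

/-! ## The stretching integral is the vorticity–Lamb pairing -/

/-- **The cut-off identity.** For `u ∈ C²` divergence-free with `ω = curl u` and the smooth cut-off
`χ = cutoff R` (`R > 0`):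
`∫ χ⟪ω, Du ω⟫ = −∫ (Dχ ω)⟪u, ω⟫ + ∫ χ⟪u, ω × curl ω⟫ + ∫ ½‖ω‖²⟪u, ∇χ⟫`
(trilinear integration by parts with `div ω = 0`, the Lamb form of `Dω ω`, and
`∫χ⟪u, ∇(½‖ω‖²)⟫ = −∫ ½‖ω‖²⟪u, ∇χ⟫` by `div u = 0`; every integrand is continuous with compact
support). [folklore] -/
theorem integral_cutoff_mul_stretching_eq (hu : ContDiff ℝ 2 u) (hdiv : VectorCalculus.IsDivFree u)
    {R : ℝ} (hR : 0 < R) :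
    ∫ x, cutoff R x * ⟪curl u x, fderiv ℝ u x (curl u x)⟫ =
      -(∫ x, fderiv ℝ (cutoff R) x (curl u x) * ⟪u x, curl u x⟫) +
        (∫ x, cutoff R x * ⟪u x, cross (curl u x) (curl (curl u) x)⟫) +
          ∫ x, ‖curl u x‖ ^ 2 / 2 * ⟪u x, gradient (cutoff R) x⟫ := by
  have hu1 : ContDiff ℝ 1 u := hu.of_le (by norm_num)
  have hom1 : ContDiff ℝ 1 (curl u) := contDiff_one_curl_of_contDiff_two hu
  set om : EuclideanSpace ℝ (Fin 3) → EuclideanSpace ℝ (Fin 3) := curl u with homdef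
  set chi : EuclideanSpace ℝ (Fin 3) → ℝ := cutoff R with hchidef
  have hchi : ContDiff ℝ 1 chi := contDiff_cutoff R
  have hcchi : HasCompactSupport chi := hasCompactSupport_cutoff hR
  have com : Continuous om := hom1.continuous
  have cDom : Continuous (fderiv ℝ om) := hom1.continuous_fderiv one_ne_zero
  have cDu : Continuous (fderiv ℝ u) := hu1.continuous_fderiv one_ne_zero
  have cchi : Continuous chi := hchi.continuous
  have cDchi : Continuous (fderiv ℝ chi) := hchi.continuous_fderiv one_ne_zero
  have hcDchi : HasCompactSupport (fderiv ℝ chi) := hcchi.fderiv (𝕜 := ℝ)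
  have hdivom : ∀ x, VectorCalculus.divergence om x = 0 := fun x => divergence_curl_eq_zero_holds u hu x
  -- (1) trilinear integration by parts against the test field `chi om`
  have hw : ContDiff ℝ 1 fun x => chi x • om x := hchi.smul hom1
  have hcw : HasCompactSupport fun x => chi x • om x := hcchi.smul_right
  have h3 := integral_inner_convect_add_eq_zero (u := om) (v := u) (w := fun x => chi x • om x) hom1 hu1 hw hcw
  have hzero : ∫ x, VectorCalculus.divergence om x * ⟪u x, chi x • om x⟫ = 0 := by
    simp [hdivom]
  rw [hzero, add_zero] at h3
  -- first term: `∫⟪Du om, chi om⟫ = ∫ chi⟪om, Du om⟫`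
  have hT1 : ∫ x, ⟪convect om u x, chi x • om x⟫ = ∫ x, chi x * ⟪om x, fderiv ℝ u x (om x)⟫ :=
    integral_congr_ae (Eventually.of_forall fun x => by
      simp only [convect_apply, real_inner_smul_right, real_inner_comm (om x)])
  -- second term: `⟪u, (om·∇)(chi om)⟫ = chi⟪u, Dω om⟫ + (Dχ om)⟪u, om⟫`
  have hT2pt : ∀ x, ⟪u x, convect om (fun y => chi y • om y) x⟫ =
      chi x * ⟪u x, fderiv ℝ om x (om x)⟫ + fderiv ℝ chi x (om x) * ⟪u x, om x⟫ := fun x => by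
    rw [convect_smul_apply (hchi.differentiable one_ne_zero x) (hom1.differentiable one_ne_zero x),
      inner_add_right, real_inner_smul_right, real_inner_smul_right, convect_apply]
  have iA1 : Integrable (fun x => chi x * ⟪u x, fderiv ℝ om x (om x)⟫) :=
    (cchi.mul (hu.continuous.inner (cDom.clm_apply com))).integrable_of_hasCompactSupport hcchi.mul_right
  have iA2 : Integrable (fun x => fderiv ℝ chi x (om x) * ⟪u x, om x⟫) :=
    ((cDchi.clm_apply com).mul (hu.continuous.inner com)).integrable_of_hasCompactSupport
      ((hcDchi.mono fun x hx => by contrapose! hx; simp_all)).mul_right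
  have hT2 : ∫ x, ⟪u x, convect om (fun y => chi y • om y) x⟫ =
      (∫ x, chi x * ⟪u x, fderiv ℝ om x (om x)⟫) + ∫ x, fderiv ℝ chi x (om x) * ⟪u x, om x⟫ := by
    rw [integral_congr_ae (Eventually.of_forall hT2pt), integral_add iA1 iA2]
  rw [hT1, hT2] at h3
  -- (2) the Lamb form: `chi⟪u, Dω om⟫ = −chi⟪u, om × curl om⟫ + chi⟪u, ∇(½‖om‖²)⟫`
  set ph : EuclideanSpace ℝ (Fin 3) → ℝ := fun y => ‖om y‖ ^ 2 / 2 with hphdef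
  have hph : ContDiff ℝ 1 ph := (hom1.norm_sq ℝ).div_const 2
  have hLamb : ∀ x, chi x * ⟪u x, fderiv ℝ om x (om x)⟫ =
      -(chi x * ⟪u x, cross (om x) (curl om x)⟫) + chi x * ⟪u x, gradient ph x⟫ := fun x => by
    have hL := convect_self_eq_cross_curl_add_gradient (hom1.differentiable one_ne_zero x)
    rw [convect_apply] at hL
    rw [hL, inner_add_right, inner_cross_swap (u x) (curl om x) (om x)]
    ring
  have iB1 : Integrable (fun x => chi x * ⟪u x, cross (om x) (curl om x)⟫) :=
    (cchi.mul (continuous_inner_cross_curl hu)).integrable_of_hasCompactSupport hcchi.mul_right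
  have iB2 : Integrable (fun x => chi x * ⟪u x, gradient ph x⟫) :=
    (cchi.mul (hu.continuous.inner (continuous_gradient_of_contDiff hph))).integrable_of_hasCompactSupport
      hcchi.mul_right
  have hL2 : ∫ x, chi x * ⟪u x, fderiv ℝ om x (om x)⟫ =
      -(∫ x, chi x * ⟪u x, cross (om x) (curl om x)⟫) + ∫ x, chi x * ⟪u x, gradient ph x⟫ := by
    have iB1n : Integrable (fun x => -(chi x * ⟪u x, cross (om x) (curl om x)⟫)) := iB1.neg
    rw [integral_congr_ae (Eventually.of_forall hLamb), integral_add iB1n iB2, integral_neg]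
  -- (3) the Bernoulli term: `∫ chi⟪u, ∇ph⟫ = −∫ ph⟪u, ∇chi⟫` (`div u = 0`)
  have hθ : ContDiff ℝ 1 fun y => chi y * ph y := hchi.mul hph
  have hcθ : HasCompactSupport fun y => chi y * ph y := hcchi.mul_right
  have h4 := integral_mul_divergence_add_eq_zero_left hθ hu1 hcθ
  have hzero' : ∫ x, chi x * ph x * VectorCalculus.divergence u x = 0 := by
    simp [hdiv _]
  rw [hzero', zero_add] at h4
  have hgradpt : ∀ x, ⟪u x, gradient (fun y => chi y * ph y) x⟫ =
      chi x * ⟪u x, gradient ph x⟫ + ph x * ⟪u x, gradient chi x⟫ := fun x => by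
    rw [gradient_mul_apply (hchi.differentiable one_ne_zero x) (hph.differentiable one_ne_zero x),
      inner_add_right, real_inner_smul_right, real_inner_smul_right]
  have hcC2 : HasCompactSupport (fun x => ph x * ⟪u x, gradient chi x⟫) := by
    refine hcchi.mono' fun x hx => ?_
    contrapose! hx
    simp only [mem_support, not_not]
    rw [gradient_eq_zero_of_notMem_tsupport hx, inner_zero_right, mul_zero]
  have iC2 : Integrable (fun x => ph x * ⟪u x, gradient chi x⟫) :=
    (hph.continuous.mul (hu.continuous.inner (continuous_gradient_of_contDiff hchi)))
      |>.integrable_of_hasCompactSupport hcC2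
  rw [integral_congr_ae (Eventually.of_forall hgradpt), integral_add iB2 iC2] at h4
  have hL3 : ∫ x, chi x * ⟪u x, gradient ph x⟫ = -∫ x, ph x * ⟪u x, gradient chi x⟫ := by linarith
  -- assemble
  rw [hL2, hL3] at h3
  have hph' : ∫ x, ph x * ⟪u x, gradient chi x⟫ = ∫ x, ‖om x‖ ^ 2 / 2 * ⟪u x, gradient chi x⟫ := rfl
  rw [hph'] at h3
  linarith

/-- **The stretching integral is the vorticity–Lamb pairing** on the exact class of
`DepletionLadder.StretchingDepletion`: for `u ∈ C²(ℝ³; ℝ³)` divergence-free, bounded by `M`, with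
`om = curl u ∈ L²`, `|∇om|_F ∈ L²` and integrable stretching density,
`∫ ⟪om, Du om⟫ = ∫ ⟪u, om × curl om⟫` (and the right integrand is integrable,
`integrable_inner_cross_curl`). Proof: the cut-off identity at `R = n + 1` and `n → ∞`: the two
cut-off error terms are `≤ C·M·‖om‖₂²/R`, the main terms converge by dominated convergence.
[folklore] -/
theorem integral_stretching_eq_integral_inner_cross (hu : ContDiff ℝ 2 u)
    (hdiv : VectorCalculus.IsDivFree u) (hM : ∀ x, ‖u x‖ ≤ M)
    (iZ : Integrable (fun x => ‖curl u x‖ ^ 2))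
    (iA : Integrable (fun x => frobeniusNormSq (fderiv ℝ (curl u) x)))
    (iJ : Integrable (fun x => ⟪curl u x, fderiv ℝ u x (curl u x)⟫)) :
    ∫ x, ⟪curl u x, fderiv ℝ u x (curl u x)⟫ =
      ∫ x, ⟪u x, cross (curl u x) (curl (curl u) x)⟫ := by
  obtain ⟨C, hC0, hC⟩ := exists_norm_fderiv_cutoff_le (E := EuclideanSpace ℝ (Fin 3))
  have hu1 : ContDiff ℝ 1 u := hu.of_le (by norm_num)
  have hom1 : ContDiff ℝ 1 (curl u) := contDiff_one_curl_of_contDiff_two hu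
  have com : Continuous (curl u) := hom1.continuous
  have hM0 : 0 ≤ M := (norm_nonneg _).trans (hM 0)
  set Z : ℝ := ∫ x, ‖curl u x‖ ^ 2 with hZdef
  set J : ℝ := ∫ x, ⟪curl u x, fderiv ℝ u x (curl u x)⟫ with hJdef
  set I : ℝ := ∫ x, ⟪u x, cross (curl u x) (curl (curl u) x)⟫ with hIdef
  have iI : Integrable (fun x => ⟪u x, cross (curl u x) (curl (curl u) x)⟫) :=
    integrable_inner_cross_curl hu hM iZ iA
  -- the four sequences
  set a : ℕ → ℝ := fun n => ∫ x, cutoff ((n : ℝ) + 1) x * ⟪curl u x, fderiv ℝ u x (curl u x)⟫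
  set b : ℕ → ℝ := fun n => ∫ x, fderiv ℝ (cutoff ((n : ℝ) + 1)) x (curl u x) * ⟪u x, curl u x⟫
  set c : ℕ → ℝ := fun n => ∫ x, cutoff ((n : ℝ) + 1) x * ⟪u x, cross (curl u x) (curl (curl u) x)⟫
  set d : ℕ → ℝ := fun n => ∫ x, ‖curl u x‖ ^ 2 / 2 * ⟪u x, gradient (cutoff ((n : ℝ) + 1)) x⟫
  have hid : ∀ n : ℕ, a n = -b n + c n + d n := fun n =>
    integral_cutoff_mul_stretching_eq hu hdiv (by positivity)
  -- (a) `a n → J`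
  have cstr : Continuous fun x => ⟪curl u x, fderiv ℝ u x (curl u x)⟫ :=
    com.inner ((hu1.continuous_fderiv one_ne_zero).clm_apply com)
  have ha : Tendsto a atTop (𝓝 J) := by
    refine tendsto_integral_of_dominated_convergence (fun x => ‖⟪curl u x, fderiv ℝ u x (curl u x)⟫‖)
      (fun n => (((contDiff_cutoff (n := 1) ((n : ℝ) + 1)).continuous).mul cstr).aestronglyMeasurable)
      iJ.norm (fun n => Eventually.of_forall fun x => ?_) (Eventually.of_forall fun x => ?_)
    · rw [norm_mul, Real.norm_eq_abs]
      exact mul_le_of_le_one_left (norm_nonneg _) (abs_cutoff_le_one _ x)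
    · have h := (tendsto_cutoff_natCast_add_one x).mul_const ⟪curl u x, fderiv ℝ u x (curl u x)⟫
      rwa [one_mul] at h
  -- (c) `c n → I`
  have hc' : Tendsto c atTop (𝓝 I) := by
    refine tendsto_integral_of_dominated_convergence
      (fun x => ‖⟪u x, cross (curl u x) (curl (curl u) x)⟫‖)
      (fun n => (((contDiff_cutoff (n := 1) ((n : ℝ) + 1)).continuous).mul
        (continuous_inner_cross_curl hu)).aestronglyMeasurable)
      iI.norm (fun n => Eventually.of_forall fun x => ?_) (Eventually.of_forall fun x => ?_)
    · rw [norm_mul, Real.norm_eq_abs]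
      exact mul_le_of_le_one_left (norm_nonneg _) (abs_cutoff_le_one _ x)
    · have h := (tendsto_cutoff_natCast_add_one x).mul_const ⟪u x, cross (curl u x) (curl (curl u) x)⟫
      rwa [one_mul] at h
  -- (b), (d) `→ 0`: both integrands are `≤ (C/(n+1))·M·‖om‖²` in norm
  have iZM : ∀ n : ℕ, Integrable (fun x => C / ((n : ℝ) + 1) * M * ‖curl u x‖ ^ 2) := fun n =>
    iZ.const_mul _
  have hbd_b : ∀ n : ℕ, ‖b n‖ ≤ C / ((n : ℝ) + 1) * M * Z := by
    intro n
    have h := norm_integral_le_of_norm_le (iZM n) (Eventually.of_forall fun x => (?_ :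
      ‖fderiv ℝ (cutoff ((n : ℝ) + 1)) x (curl u x) * ⟪u x, curl u x⟫‖ ≤
        C / ((n : ℝ) + 1) * M * ‖curl u x‖ ^ 2))
    · rw [integral_const_mul] at h
      exact h
    · rw [norm_mul, Real.norm_eq_abs, Real.norm_eq_abs]
      have h1 : |fderiv ℝ (cutoff ((n : ℝ) + 1)) x (curl u x)| ≤ C / ((n : ℝ) + 1) * ‖curl u x‖ :=
        (Real.norm_eq_abs _ ▸ ((fderiv ℝ (cutoff ((n : ℝ) + 1)) x).le_opNorm _)).trans
          (mul_le_mul_of_nonneg_right (hC _ (by positivity) x) (norm_nonneg _))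
      have h2 : |⟪u x, curl u x⟫| ≤ M * ‖curl u x‖ :=
        (abs_real_inner_le_norm _ _).trans (mul_le_mul_of_nonneg_right (hM x) (norm_nonneg _))
      calc |fderiv ℝ (cutoff ((n : ℝ) + 1)) x (curl u x)| * |⟪u x, curl u x⟫|
          ≤ (C / ((n : ℝ) + 1) * ‖curl u x‖) * (M * ‖curl u x‖) :=
            mul_le_mul h1 h2 (abs_nonneg _) (by positivity)
        _ = C / ((n : ℝ) + 1) * M * ‖curl u x‖ ^ 2 := by ring
  have hbd_d : ∀ n : ℕ, ‖d n‖ ≤ C / ((n : ℝ) + 1) * M * Z := by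
    intro n
    have h := norm_integral_le_of_norm_le (iZM n) (Eventually.of_forall fun x => (?_ :
      ‖‖curl u x‖ ^ 2 / 2 * ⟪u x, gradient (cutoff ((n : ℝ) + 1)) x⟫‖ ≤
        C / ((n : ℝ) + 1) * M * ‖curl u x‖ ^ 2))
    · rw [integral_const_mul] at h
      exact h
    · rw [norm_mul, Real.norm_eq_abs, Real.norm_eq_abs, abs_of_nonneg (by positivity)]
      have h2 : |⟪u x, gradient (cutoff ((n : ℝ) + 1)) x⟫| ≤ M * (C / ((n : ℝ) + 1)) := by
        refine (abs_real_inner_le_norm _ _).trans (mul_le_mul (hM x) ?_ (norm_nonneg _) hM0)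
        rw [gradient, LinearIsometryEquiv.norm_map]
        exact hC _ (by positivity) x
      have hω2 : 0 ≤ ‖curl u x‖ ^ 2 := sq_nonneg _
      calc ‖curl u x‖ ^ 2 / 2 * |⟪u x, gradient (cutoff ((n : ℝ) + 1)) x⟫|
          ≤ ‖curl u x‖ ^ 2 / 2 * (M * (C / ((n : ℝ) + 1))) :=
            mul_le_mul_of_nonneg_left h2 (by positivity)
        _ ≤ ‖curl u x‖ ^ 2 * (M * (C / ((n : ℝ) + 1))) := by
            nlinarith [mul_nonneg hM0 (show 0 ≤ C / ((n : ℝ) + 1) by positivity)]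
        _ = C / ((n : ℝ) + 1) * M * ‖curl u x‖ ^ 2 := by ring
  have hrate : Tendsto (fun n : ℕ => C / ((n : ℝ) + 1) * M * Z) atTop (𝓝 0) := by
    have h0 : Tendsto (fun n : ℕ => C / ((n : ℝ) + 1)) atTop (𝓝 0) := by
      have h := (tendsto_one_div_add_atTop_nhds_zero_nat (𝕜 := ℝ)).const_mul C
      rw [mul_zero] at h
      refine h.congr fun n => ?_
      rw [mul_one_div]
    have h := (h0.mul_const M).mul_const Z
    rwa [zero_mul, zero_mul] at h
  have hb : Tendsto b atTop (𝓝 0) :=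
    squeeze_zero_norm hbd_b hrate
  have hd : Tendsto d atTop (𝓝 0) :=
    squeeze_zero_norm hbd_d hrate
  -- conclude
  have hsum : Tendsto (fun n => -b n + c n + d n) atTop (𝓝 (-0 + I + 0)) := (hb.neg.add hc').add hd
  rw [neg_zero, zero_add, add_zero] at hsum
  have ha' : Tendsto a atTop (𝓝 I) := hsum.congr fun n => (hid n).symm
  exact tendsto_nhds_unique ha ha'

end Class

end Summit.NavierStokesRegularity.NavierStokesRegularity.Theorems.DepletionLadder

end
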